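import Summits.MatrixMultiplication.MatrixMultiplication.Theorems.SesquiTensor
import HarnessLib

/-!
# SesquiTensorCut — the exact cut `ω(ℂ) = 2 ⟺ [Ω ≤ 10] ∧ [5ω ≤ Ω]` on the sesqui-weighted
tetrahedron `S_n = T(K₄)_n ⊠ W_n`, the three family cuts side by side, the grouping bound
`ω(6,4,3) ≤ Ω`, what `SesquiFlat` gives alone (`ω(6,4,3) = 10`, `ω ≤ 30/13`), and the
grouping-class certificate `5ω ≤ ω(6,4,3) ⟺ ω = 2`

(decomp-mm lens 6 «barrier-complement carving», gen 15; companion of `SesquiTensorCore` /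
`SesquiTensor`, which carry the tensor, the bracket `10 ≤ Ω ≤ min(5ω, ω(K₄) + ω(W))` and the rim
cover `3·ω(K₄) ≤ ω + Ω`.)

Over `ℂ`: `ω = 2 ⟹ 5ω = 10 ≤ Ω` and `ω = 2 ⟹ Ω ≤ 5ω = 10` (both halves NECESSARY), and
`Ω ≤ 10 ∧ 5ω ≤ Ω ⟹ ω ≤ 2` with `omega_two_le` (SUFFICIENT): `matrixMultiplication_iff_sesqui`.
GROUPING CLASS: `ω(6,4,3) ≤ Ω` (rim vertices `2,3` one party, rim edge `23` frozen;
`tensorRank_matMulTensor_le_tensorRankD_sesqui`), `10 ≤ ω(6,4,3) ≤ 3ω + 4` (Huang–Pan information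
bound; Lotti–Romani `ω(6,4,3) ≤ ω(3,3,3) + ω(3,1,0)`), hence the CERTIFICATE
`5ω ≤ ω(6,4,3) ⟺ ω = 2`: a proof of the residual `5ω ≤ Ω` through the grouping bound is a proof
of the summit. `SesquiFlat` ALONE gives `ω(6,4,3) = 10` (i.e. `⟨n, n^{3/4}, n^{3/2}⟩` tight — the
long shape `(t, r) = (3/4, 3/2)` of the census table `cllz-cw-rect-barrier-v2.md`, Table B: NOT
barred for `q = 1`, `abar₁(1.5) = 0.760381 ≥ 0.75`, barred for every `q ≥ 2`) and, by the cyclic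
Lotti–Romani product, `13ω ≤ 30`, `ω ≤ 30/13 < 2.3077`. No `sorry`, no new axiom, no instance, no
notation, no `Prop`-valued definition.
-/

noncomputable section

set_option linter.dupNamespace false

open scoped BigOperators
open Filter Asymptotics Module
open Literature.Computability.AlgebraicComplexity
open Summit.MatrixMultiplication.MatrixMultiplication.Theorems.TetrahedronTensor
open Summit.MatrixMultiplication.MatrixMultiplication.Theorems.ConeTensor

namespace Summit.MatrixMultiplication.MatrixMultiplication.Theorems.SesquiTensor

/-! ## Against the summit `ω(ℂ) = 2`: necessity of both halves, sufficiency, exactness -/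

section Summit

/-- NEC of the «no saving» half: `ω = 2 ⟹ 5ω = 10 ≤ Ω` (flattening).
[cite: ChristandlVranaZuiddam2016, §1.3] -/
theorem five_mul_omega_le_omegaSesqui_of_matrixMultiplication (hS : _root_.MatrixMultiplication) :
    5 * omega ℂ ≤ omegaSesqui ℂ := by
  have hω : omega ℂ = 2 := (_root_.MatrixMultiplication_iff).1 hS
  rw [hω]
  have := ten_le_omegaSesqui ℂ
  linarith

/-- NEC of the «flat» half: `ω = 2 ⟹ Ω ≤ 5ω = 10` (the five-triangle cover; CVZ19 §1.3: if `ω = 2`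
every graph tensor sits at its flattening exponent). [cite: ChristandlVranaZuiddam2016, §1.3] -/
theorem omegaSesqui_le_ten_of_matrixMultiplication (hS : _root_.MatrixMultiplication) :
    omegaSesqui ℂ ≤ 10 := by
  have hω : omega ℂ = 2 := (_root_.MatrixMultiplication_iff).1 hS
  have hcov := omegaSesqui_le_five_mul_omega ℂ
  rw [hω] at hcov
  linarith

/-- SUFFICIENCY: `Ω ≤ 10` and `5ω ≤ Ω` give `ω ≤ 2`; `2 ≤ ω` is `omega_two_le`. [folklore] -/
theorem matrixMultiplication_of_sesqui (hA : omegaSesqui ℂ ≤ 10)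
    (hB : 5 * omega ℂ ≤ omegaSesqui ℂ) : _root_.MatrixMultiplication := by
  refine (_root_.MatrixMultiplication_iff).2 (le_antisymm ?_ (omega_two_le ℂ))
  linarith

/-- **EXACT CUT (kernel)**: `ω(ℂ) = 2 ⟺ [Ω ≤ 10] ∧ [5ω ≤ Ω]` — the sesqui-weighted tetrahedron sits
at its flattening exponent AND nothing is saved over the five-triangle cover. [cite: ChristandlVranaZuiddam2016, §1.3] -/
theorem matrixMultiplication_iff_sesqui :
    _root_.MatrixMultiplication ↔ (omegaSesqui ℂ ≤ 10 ∧ 5 * omega ℂ ≤ omegaSesqui ℂ) :=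
  ⟨fun hS => ⟨omegaSesqui_le_ten_of_matrixMultiplication hS,
      five_mul_omega_le_omegaSesqui_of_matrixMultiplication hS⟩,
    fun h => matrixMultiplication_of_sesqui h.1 h.2⟩

/-- The «flat» half is the VALUE statement `Ω = 10`. [folklore] -/
theorem omegaSesqui_le_ten_iff : omegaSesqui ℂ ≤ 10 ↔ omegaSesqui ℂ = 10 :=
  ⟨fun h => le_antisymm h (ten_le_omegaSesqui ℂ), fun h => h.le⟩

/-- The «no saving» half is the VALUE statement `Ω = 5ω`. [folklore] -/
theorem five_mul_omega_le_omegaSesqui_iff :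
    5 * omega ℂ ≤ omegaSesqui ℂ ↔ omegaSesqui ℂ = 5 * omega ℂ :=
  ⟨fun h => le_antisymm (omegaSesqui_le_five_mul_omega ℂ) h, fun h => h.ge⟩

/-- **THE THREE CUTS OF THE FAMILY SIDE BY SIDE** (all kernel): `ω = 2` iff the tetrahedron cut, iff
the sesqui cut, iff the cone cut. [folklore] -/
theorem matrixMultiplication_iff_family :
    (_root_.MatrixMultiplication ↔ (omegaTetra ℂ ≤ 4 ∧ 2 * omega ℂ ≤ omegaTetra ℂ)) ∧
    (_root_.MatrixMultiplication ↔ (omegaSesqui ℂ ≤ 10 ∧ 5 * omega ℂ ≤ omegaSesqui ℂ)) ∧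
    (_root_.MatrixMultiplication ↔ (omegaCone ℂ ≤ 6 ∧ 3 * omega ℂ ≤ omegaCone ℂ)) :=
  ⟨matrixMultiplication_iff_tetra, matrixMultiplication_iff_sesqui, matrixMultiplication_iff_cone⟩

end Summit

/-! ## Grouping class: `ω(6,4,3) ≤ Ω`, what `SesquiFlat` gives alone, and the certificate
`5ω ≤ ω(6,4,3) ⟺ ω = 2` -/

section Grouping

variable (F : Type) [Field F]

/-- Every admissible exponent of `S` is admissible for `(6,4,3)`-rectangular matrix multiplication
(`⌈n⁶⌉ = n²·n⁴`, `⌈n⁴⌉ = n²·n²`, `⌈n³⌉ = n·n²`, and the grouping transfer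
`R(⟨n⁶,n⁴,n³⟩) ≤ R₄(S_n)`). [folklore] -/
theorem sesquiAdmissibleExponents_subset_rect :
    sesquiAdmissibleExponents F ⊆ rectAdmissibleExponents F 6 4 3 := by
  intro β hβ
  refine IsBigO.trans ?_ hβ
  refine IsBigO.of_bound 1 ?_
  filter_upwards [eventually_ge_atTop 1] with n hn
  rw [one_mul, Real.norm_of_nonneg (Nat.cast_nonneg _), Real.norm_of_nonneg (Nat.cast_nonneg _)]
  haveI : NeZero n := ⟨by omega⟩
  have h6 : rectDim n 6 = n * n * (n * n * (n * n)) := by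
    rw [show (6 : ℝ) = ((6 : ℕ) : ℝ) by norm_num, rectDim_natCast]
    ring
  have h4 : rectDim n 4 = n * n * (n * n) := by
    rw [show (4 : ℝ) = ((4 : ℕ) : ℝ) by norm_num, rectDim_natCast]
    ring
  have h3 : rectDim n 3 = n * (n * n) := by
    rw [show (3 : ℝ) = ((3 : ℕ) : ℝ) by norm_num, rectDim_natCast]
    ring
  rw [tensorRank_matMulTensor_congr F h6 h4 h3]
  exact_mod_cast tensorRank_matMulTensor_le_tensorRankD_sesqui (F := F) n

/-- **`ω(6,4,3) ≤ Ω`** (grouping the rim vertices `2,3` of `S` into one party, rim edge `23` frozen) —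
the only lower-bound instrument for `Ω` in the tree. [folklore] -/
theorem omegaRect_six_four_three_le_omegaSesqui : omegaRect F 6 4 3 ≤ omegaSesqui F :=
  csInf_le_csInf (rectAdmissibleExponents_bddBelow F 6 4 3) (sesquiAdmissibleExponents_nonempty F)
    (sesquiAdmissibleExponents_subset_rect F)

/-- **`10 ≤ ω(6,4,3)`** (information bound). [cite: HuangPan1998, §2 eq. (2.8) (p. 262)] -/
theorem ten_le_omegaRect_six_four_three : 10 ≤ omegaRect F 6 4 3 := by
  have h := add_le_omegaRect₁₂ F 6 4 3
  norm_num at h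
  exact h

/-- `ω(3,3,3) = 3ω` (homogeneity). [cite: LottiRomani1983, §1 (p. 173)] -/
theorem omegaRect_three_three_three : omegaRect F 3 3 3 = 3 * omega F := by
  have hs := omegaRect_smul (K := F) (t := 3) (by norm_num) (a := 1) (b := 1) (c := 1)
    (by norm_num) (by norm_num) (by norm_num)
  rw [omegaRect_one_one_one] at hs
  norm_num at hs
  exact hs

/-- **`ω(6,4,3) ≤ 3ω + 4`** (Lotti–Romani subadditivity `ω(6,4,3) ≤ ω(3,3,3) + ω(3,1,0)` with
`ω(3,1,0) = 4`): the grouping bound of `S` is within `4` of `3ω`, so it can certify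
`SesquiNoSaving : 5ω ≤ Ω` only if `ω ≤ 2`. [cite: LottiRomani1983, §1 (p. 173)] -/
theorem omegaRect_six_four_three_le : omegaRect F 6 4 3 ≤ 3 * omega F + 4 := by
  have hsub := LottiRomani1983_subadditive F 3 3 3 3 1 0
  have h310 : omegaRect F 3 1 0 = 3 + 1 :=
    omegaRect_eq_add_of_nonpos₃ F (by norm_num) (by norm_num) (le_refl 0)
  rw [omegaRect_three_three_three] at hsub
  norm_num at hsub h310
  rw [h310] at hsub
  linarith

/-- **CERTIFICATE (sesqui)**: `5ω ≤ ω(6,4,3) ⟺ ω = 2` over `ℂ` — a proof of `SesquiNoSaving` through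
the grouping lower bound `ω(6,4,3) ≤ Ω` is a proof of the summit (same shape as the gen-13/14
certificates `2ω ≤ ω(2,1,2) ⟺ S`, `3ω ≤ ω(4,2,2) ⟺ S`). [folklore] -/
theorem five_mul_omega_le_omegaRect_six_four_three_iff :
    5 * omega ℂ ≤ omegaRect ℂ 6 4 3 ↔ _root_.MatrixMultiplication := by
  constructor
  · intro h
    have := omegaRect_six_four_three_le ℂ
    refine (_root_.MatrixMultiplication_iff).2 (le_antisymm ?_ (omega_two_le ℂ))
    linarith
  · intro hS
    have hω : omega ℂ = 2 := (_root_.MatrixMultiplication_iff).1 hS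
    have := ten_le_omegaRect_six_four_three ℂ
    rw [hω]
    linarith

/-- **`SesquiFlat` alone**: `Ω ≤ 10 → ω(6,4,3) = 10`, i.e. `⟨n⁶, n⁴, n³⟩` (equivalently
`⟨n, n^{2/3}, n^{1/2}⟩`) at its information-theoretic exponent. [folklore] -/
theorem omegaRect_six_four_three_eq_ten_of_omegaSesqui_le_ten (h : omegaSesqui F ≤ 10) :
    omegaRect F 6 4 3 = 10 :=
  le_antisymm ((omegaRect_six_four_three_le_omegaSesqui F).trans h)
    (ten_le_omegaRect_six_four_three F)

/-- **`SesquiFlat` alone gives `ω ≤ 30/13 < 2.3077`**: the cyclic product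
`⟨n⁶,n⁴,n³⟩ ⊗ ⟨n⁴,n³,n⁶⟩ ⊗ ⟨n³,n⁶,n⁴⟩ = ⟨n¹³,n¹³,n¹³⟩` in exponent form (Lotti–Romani subadditivity,
cyclic symmetry and homogeneity): `13ω ≤ 3·ω(6,4,3) = 30` (the record is `ω < 2.371339`). [cite: LottiRomani1983, §1 (p. 173)] -/
theorem omega_le_thirty_thirteenths_of_omegaSesqui_le_ten (h : omegaSesqui F ≤ 10) :
    omega F ≤ 30 / 13 := by
  have h643 := omegaRect_six_four_three_eq_ten_of_omegaSesqui_le_ten F h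
  have h436 : omegaRect F 4 3 6 = 10 := by
    rw [omegaRect_rotate F 4 3 6, omegaRect_rotate F 3 6 4]
    exact h643
  have h364 : omegaRect F 3 6 4 = 10 := by
    rw [omegaRect_rotate F 3 6 4]
    exact h643
  have hsub1 := LottiRomani1983_subadditive F 6 4 3 4 3 6
  have hsub2 := LottiRomani1983_subadditive F (6 + 4) (4 + 3) (3 + 6) 3 6 4
  have h13 : omegaRect F 13 13 13 = 13 * omega F := by
    have hs := omegaRect_smul (K := F) (t := 13) (by norm_num) (a := 1) (b := 1) (c := 1)
      (by norm_num) (by norm_num) (by norm_num)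
    rw [omegaRect_one_one_one] at hs
    norm_num at hs
    exact hs
  norm_num at hsub1 hsub2
  rw [h13] at hsub2
  linarith

/-- `SesquiFlat` consequences side by side: `ω(6,4,3) = 10`, `ω(K₄) ≤ (ω+10)/3`, `ω ≤ 30/13`. [folklore] -/
theorem sesquiFlat_consequences (h : omegaSesqui F ≤ 10) :
    omegaRect F 6 4 3 = 10 ∧ omegaTetra F ≤ (omega F + 10) / 3 ∧ omega F ≤ 30 / 13 :=
  ⟨omegaRect_six_four_three_eq_ten_of_omegaSesqui_le_ten F h, omegaTetra_le_of_omegaSesqui_le_ten F h,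
    omega_le_thirty_thirteenths_of_omegaSesqui_le_ten F h⟩

end Grouping

end Summit.MatrixMultiplication.MatrixMultiplication.Theorems.SesquiTensor

end
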